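import Literature.MathematicalPhysics.QuantumFieldTheory.Balaban1983to89.B11Ineq190Actual
import Literature.MathematicalPhysics.QuantumFieldTheory.Balaban1983to89.B11SectGAnalyticV

/-!
# `Balaban1983to89.B11Prop9Model` — T. Bałaban, *The variational problem and background fields in renormalization group method
# for lattice gauge theories*, Commun. Math. Phys. **102** (1985) 277–309 [Balaban1985Variational], **Proposition 9** (p. 309):
# the typed statement of record `B11.Prop9Printed B₅ C₁ β₀ δ₀ fam` INHABITED BY NAME for the model family of Sect. E–G scheme data
# (kind «model-instance»), every analytic input a located hypothesis of the printed shape, the constants O(1) and «ε₁ sufficiently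
# small» explicit functions of the shared printed constants

statement-level skeleton of published theorems with citation tags; proofs where landed; nothing here is a claim about the Yang–Mills mass gap

PDF held: `paper:balaban1985-cmp102-variational-background` (journal page = PDF page + 276); pp. 305–309 [PDF 29–33].  The displays
(172)–(190) and Proposition 9 are taken in the render-verified transcriptions of record of `B11` (docstring of `B11.Prop9Printed`),
`B11SectG` ((182)–(190)), `B11Eq174Chart` ((170)–(180)), `B11SectGAnalyticV` ((172)) and `B11Eq183Differentiation` ((179)–(188)); nothing
is re-read from a secondary source.

CITATION HEADER (lean-in-tree rule 2026-08-18).  WHAT IS REPRODUCED: SKELETON row **B11.Prop9** (reader r08 `ROWS-B11.md`; decl of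
record `B11.Prop9Printed (B₅ C₁ β₀ δ₀)` over the Sect. G carrier `B11.AnData`, B11.lean :410; status before this file: typed-existing,
with the OPERATOR LAYER underneath its clauses landed piecewise — `B11Eq174Chart` (the chart 𝓗 «determined by (174), (175), or (179),
(180)», p07 g4), `B11Claim309UAnalytic` / `B11Eq183Differentiation` («analytic function of B», (182)–(188) for the actual Fréchet
derivative, r08 g9), `B11SectG` / `B11Ineq190Actual` ((189) ⇒ (190) for the actual derivative, r08 g1/g10), `B11SectGAnalyticV` ((172),
«analytic function of V′», r08 g10), `B11Eq181AnalyticExtension` ((181) «extends by analyticity», r08 g9) — but NO theorem concluding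
`B11.Prop9Printed` itself: the conjunct `p9` of the N07 leaf `DagBinding.B11Leaf` had 0 inhabitants).  THE PRINT (p. 309 [PDF 33],
verbatim): *«Proposition 9. The minimal configuration U_k(V) = U_k(V′V₀) in the axial gauge has an extension to an analytic function of
Gᶜ-valued small configurations V′ on 𝔅_k. It can be extended further to all orbits of such configurations V′V₀ by the equality (181). The
function U_k(V′V₀)U_k(V₀)⁻¹ transformed to the Landau gauge is, by the definition, equal to exp iη𝓗(B), where B = (1/i) log V′. The
function 𝓗(B) is determined by Eqs. (174), (175), or (179), (180). It is an analytic function of B, and also of the external gauge field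
configuration U satisfying the regularity conditions (3.35)–(3.38) [5], or (1.7)–(1.9) [6]. It satisfies the conditions (19)–(21) with
ε₂ = B₅ε₁ (see (173)), and its functional derivative (182) satisfies the inequalities (190).»*; (172) p. 305: *«V′ satisfies |V′ − 1| < C₁ε₁,
hence V′ = e^{iB′}, |B′| < 2C₁ε₁ on 𝔅_k, (172) for ε₁ sufficiently small»*; (190) p. 308: *«… ≤ O(1)[(Lʲη)⁻¹, (Lʲη)⁻², (‖ζ‖^#_β + |ζ|)
(Lʲη)^{−2−β}, (Lʲη)⁻³, (Lʲη)⁻³]·(L^{j′}η)^{−d} exp(−⅛δ₀d(y,y′)) (190) for x ∈ Δ(y), or supp ζ ⊂ Δ̃(y), y ∈ Λ_j, y′ ∈ Λ_{j′}.»*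

WHAT IS CERTIFIED (kernel, sorry-free; axioms `propext` / `Classical.choice` / `Quot.sound`).
§1 `GConsts` — the printed constants shared by a family (d, C₁, δ₀, β₀; B₀ = ‖G̃‖ ((117), [5] (3.42)); C₄, a₃ (Prop. 4); the norms of H₀
   ((129)–(130)), Δ⁽²⁾ ((38)–(40)), H ((46)); 4C₂ of (55); the cutting costs κ and the row-sum constant of Lemma 2.1 [3] at rate ⅛δ₀; the
   kernel letters of G̃, (189), Δ⁽²⁾H₀, H₀, H, 𝔇 ((73))) with `GConsts.Valid` (signs + the LOCATED smallness `q < 1` of (187)); the derived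
   data `alpha` (‖H₀B‖ < αε₁ for |B| < 2C₁ε₁), `jcoef` (‖Δ⁽²⁾H₀B‖ < ιε₁), `lam` (the radius ε₄ = λε₁ of (115)), `B5 = 2(λ + α)` (the ε₂ = B₅ε₁
   of (19)), the threshold `cthr` («for ε₁ sufficiently small», five explicit members), the fixed chart radius `epsStar = λ·cthr`, and the
   O(1) of (190) `O1` (= the explicit constant of the `B11SectG` chain (189) + (188) + Lemma 2.1 + (182)); **`regime_star` /
   `regime_small`**: Proposition 6's regime (117)–(121) (`B11Eq174Chart.Regime`) HOLDS at the data of (180) — ‖J‖ = ‖Δ⁽²⁾H₀B‖ ≤ ιε₁,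
   ‖𝔄‖ = ‖H₀B‖ < αε₁ — for every 0 < ε₁ ≤ cthr, at the radius `epsStar` and at the radius λε₁ (real arithmetic).
§2 `SectGDatum q 𝔄 ι 𝒴 𝒵 Bdry` — a datum of the Prop. 9 model: a multiscale geometry `g : B6.Geometry` (𝔅_k with j(y), d(y,y′), L, η), for
   each V₀ the Sect. E–G scheme data at the background U_k(V₀) over complex Banach spaces — `𝒢` = G̃, `W` = (δ/δA′)V, `D2` = Δ⁽²⁾, `H₀`, `H`
   ((45)–(46)), the Sect. C map `D` ((47)/(55)) — with `𝒳 := ι → 𝔄` the 𝔤ᶜ-valued configurations B on the bonds ι of 𝔅_k (sup norm; `𝔄` a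
   complete normed ℂ-algebra, the reading of `B11Eq172LogBound`/`B11SectGAnalyticV`), `𝒴` the space of (115), `𝒵` the space of |·|_{(−3)};
   block sizes `bB`, `bN`, `b3` and the output sizes `bout V₀ n β` (n = 0,…,4: the five local sizes of (190), scale weights inside, `B11SectG`
   convention); `SectGDatum.Letters V₀` = THE LOCATED LEAVES at the background U_k(V₀) (list in its docstring) = the model's reading of
   «V₀ satisfies (7)» (reading (R7)).  `SectGDatum.chart V₀ := chartH179 …` = 𝓗 in the representation (179)–(180) at the fixed radius
   `epsStar`; `SectGDatum.toAnData` = the Sect. G carrier `B11.AnData` of the datum with the READINGS (R1)–(R7) below.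
§3 The clauses of Proposition 9 for the model, each a theorem: `norm_H₀_lt` / `norm_D2H₀_lt` (the domain of (180) contains the ball (172));
   **`hDet_model`** («determined by Eqs. (179), (180)»: existence AND uniqueness of 𝒜₀ in the ball (115), `B11Eq183Differentiation.eq180` +
   `Regime.eq_solA`); **`hAnalytic_model`** («It is an analytic function of B» on |B| < 2C₁ε₁, `analyticOnNhd_chartH179`);
   **`norm_chart_lt`** («It satisfies the conditions (19)–(21) with ε₂ = B₅ε₁»: ‖𝓗(B)‖ < B₅ε₁ from ‖𝒜₀‖ ≤ λε₁ (nested radii,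
   `Regime.solA_eq_of_le`), ‖H₀B‖ < αε₁ and (55)); **`extAnalytic_model`** («an analytic function of Gᶜ-valued small configurations V′»,
   V′ ↦ 𝓗((1/i) log V′) on {|V′ − 1| < C₁ε₁}, `B11SectGAnalyticV.analyticOnNhd_comp_logCfg_ball` + (172)); **`extOrbits_model`** (the
   identity principle on that domain, Mathlib `AnalyticOnNhd.eqOn_of_preconnected_of_eventuallyEq` on the convex set); **`ineq190_model`**
   ((190) for the ACTUAL derivative (δ/δB)𝓗(B) into every output size `bout V₀ n β`, constant `O1`: the `B11SectG` chain
   `A0_majorant_of_189` → `A0_strong_of_184` → `dH_majorant_of_182` fed with `B11Eq183Differentiation.eq184_sectG` / `eq182_sectG` /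
   `bound188_sectG` at the regime of §1); `dH_le` (the displayed form with the prefactors `B11.pref190` and (L^{j′}η)^{−d}).
§4 **`prop9Printed_model : q.Valid → B11.Prop9Printed q.B5 q.C₁ q.β₀ q.δ₀ (fun i => (δ i).toAnData)`** for EVERY family of data sharing
   `q` (carriers varying with the index), with O(1) := `O1 q` and the threshold := `cthr q` chosen BEFORE the index; `prop9Printed_model_of_le`
   (any B₅ ≥ `B5 q`, e.g. print's 6B₁B₃C₁ when larger).

MODEL / DECLARED READINGS.  (R1) B = (1/i) log V′ ∈ `ι → 𝔄` with the sup norm and `bnorm := ‖·‖`; «Gᶜ-valued small configurations V′»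
= `{V′ : ∀ b, ‖V′ b − 1‖ < r}` ((V1) of `B11SectGAnalyticV`).  (R2) «U_k(V′V₀) in the axial gauge … analytic function of V′» is READ
through Prop. 9's own identification «U_k(V′V₀)U_k(V₀)⁻¹ transformed to the Landau gauge is, by the definition, equal to exp iη𝓗(B)»:
`ExtAnalytic r V₀ :=` analyticity of `V′ ↦ 𝓗(B(V′))` on that set (the bondwise exponential and the transformation back to the axial gauge
are analytic maps OF 𝓗 — `B11SectGAnalyticV.analyticOnNhd_U1_of_V` / `analyticOnNhd_axial_of_V` — and are not carried).  (R3) «extended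
further to all orbits … by the equality (181)»: (181) is used in print as a DEFINITION of the extension; what makes it consistent on the
analyticity domain is the uniqueness of analytic continuation there (*«This equality extends by analyticity»*, p. 307) — `ExtOrbits r V₀ :=`
every function analytic on the (open, convex) domain that agrees with `V′ ↦ 𝓗(B(V′))` near V′ = 1 agrees with it on the whole domain;
the real-slice step G → Gᶜ of p. 307 is `B11Eq181AnalyticExtension.eq181_extends_by_analyticity` (coordinates ℂⁿ) and is NOT
re-instantiated on `ι → 𝔄`.  (R4) «determined by Eqs. (174), (175), or (179), (180)»: the representation (179)–(180) (the one (182)–(190)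
differentiate), at ONE fixed admissible radius `epsStar` of (115) (the chart does not depend on the auxiliary radius,
`B11Eq174Chart.Regime.chartH_eq_of_le`); «also of the external gauge field configuration U» is `B11Claim309UAnalytic` and is not a clause
of `HAnalytic` here (the model's data ARE the data at U = U_k(V₀)).  (R5) «the conditions (19)–(21) with ε₂ = B₅ε₁»: (19) in the ONE norm
of (115) (`HIn19_21 ε₂ V₀ B := ‖𝓗(B)‖ < ε₂`); (20)–(21) are identities of the construction ((48), (102), Q𝔊 = 0) and are not typed; the
model's B₅ = 2(λ + α) comes from the chart bound, print's B₅ = 6B₁B₃C₁ from Thm 1 + Prop. 2 at the data V′V₀ ((173)) — `_of_le` covers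
any larger B₅.  (R6) THE ENTRIES OF (190): `dH n β V₀ B y y′ := pref190(Lʲη, β)_n · (L^{j′}η)^{−d} · sup{ size_{n,β,y}((δ/δB)𝓗(B)·μ) :
μ localised at y′, |μ|_{y′} ≤ 1 }` — the worst response near y of the n-th printed quantity to a unit perturbation of B localised at y′,
which DOMINATES the printed left-hand side (the response to the unit perturbation at the single bond (ν, y′)); the scale weights
(Lʲη)^{1,2,2+β,3,3} live INSIDE the sizes `bout V₀ n β` and (L^{j′}η)^{−d} is the normalisation of the functional derivative w.r.t. the
η-scale pairing on 𝔅_k — verbatim the typing convention of `B11SectG.Ineq190`, of which `dH_le` is the dictionary.  (R7) (7) for V₀ is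
READ as `SectGDatum.Letters V₀` — the located operator letters at the background U_k(V₀) with constants uniform in V₀ (print uses (7)
for V₀ only through Theorem 1: U_k(V₀) is the regular minimal configuration, so the operator theory of [5] at the background U_k(V₀) is
available — the pattern (M7-b) of `B11Prop7Model`: «(7) read as the consequences of (7) the proof uses»).
HONEST SCOPE — what is NOT proved here: every field of `SectGDatum.Letters` and the geometry letters of `SectGDatum` (the lattice content:
[5] Thms 3.3/3.12/3.13 for G̃, H₀, H; Prop. 4; Prop. 3 (55)/(73); (189) — author-omitted, cell GAPS G-B11-G2 —; Lemma 2.1 [3]; the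
smallness (187) in `GConsts.Valid`); the words *«and finally
Proposition 2 and (181)»* of (190) (transport to a general base point, G-B11-G2a); (173) via Thm 1; (20)–(21); the G → Gᶜ real-slice step.
No lattice object of [4]–[6] is constructed.  Mega-formalization venue `Literature/…/Balaban1983to89/` (lit-balaban lineage r08/p07/p29
imported BY NAME, nothing there modified); seat pub-ymgap-dag-n07-b (HUMAN RULING D-0062, node N07 [B11], conjunct `p9` of
`DagBinding.B11Leaf`).  Net new unproved facts: 0 (one hypothesis structure `SectGDatum`, one constants record, definitions with bodies).
-/

noncomputable section

namespace Literature.MathematicalPhysics.QuantumFieldTheory.Balaban1983to89.B11Prop9Model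

open Set Metric Filter Topology
open Literature.MathematicalPhysics.QuantumFieldTheory.Balaban1983to89
open B11SectG B11Prop6Scheme B11Eq174Chart B11Eq183Differentiation B11Ineq190Actual B6RandomWalk

/-! ## §1 The shared printed constants, the derived thresholds, and the regime (117)–(121) at the data of (180) -/

/-- **The printed constants shared by a family of Sect. G data** (one record, fixed BEFORE the index as in *«The constants … depend on d
and L only»*): `d` the dimension and `C₁` ((14), (172)), `δ₀` the decay rate of (73)/(130)/(161)/(189)/(190), `β₀` the Hölder range of
(9)/(190); `B₀` = the norm of G̃ = GP₀* ((117); p. 306 *«the new operator G has exactly the same properties as Δ_a⁻¹»*, [5] (3.42));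
`C₄`, `a₃` = Proposition 4 ((97)–(98), the ball (77)); `AH0` = the norm of H₀ ((129)–(130), [5] (3.133)); `θ₂` = the norm of Δ⁽²⁾
((38)–(40)); `AH` = the norm of H ((46), [5] Thm 3.12); `C₂` with |D(A′)| ≤ 4C₂|A′|² ((55)); `κB`, `κN`, `κ3` = the cutting costs of the
block sizes (`B11SectG.BlockNorm.κ`); `c61` = the row-sum constant of Lemma 2.1 [3] used with the summable factor e^{−⅛δ₀d}; the kernel
letters `BG` (G̃ into the first-order size), `BG₂` (G̃ into the five output sizes), `θW` ((189): O(1)ε₃), `cΔ` (Δ⁽²⁾H₀, (130)), `A₀`/`A₀₂`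
(H₀), `AH₂` (H into the output sizes, (137)–(139)), `θD` (𝔇, (73)). [cite: Balaban1985Variational, (172)–(190) pp.305–308] -/
structure GConsts where
  /-- the dimension d -/
  d : ℕ
  /-- C₁ of (14)/(172) -/
  C₁ : ℝ
  /-- the decay rate δ₀ -/
  δ₀ : ℝ
  /-- the Hölder range β₀ of (9)/(190) -/
  β₀ : ℝ
  /-- ‖G̃‖ ≤ B₀ ((117), [5] (3.42)) -/
  B₀ : ℝ
  /-- C₄ of Prop. 4 (98) -/
  C₄ : ℝ
  /-- a₃ of Prop. 4 (the ball (77)) -/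
  a₃ : ℝ
  /-- ‖H₀‖ ≤ AH0 ((129)–(130)) -/
  AH0 : ℝ
  /-- ‖Δ⁽²⁾‖ ≤ θ₂ ((38)–(40)) -/
  θ₂ : ℝ
  /-- ‖H‖ ≤ AH ((46)) -/
  AH : ℝ
  /-- |D(A′)| ≤ 4C₂|A′|² ((55)) -/
  C₂ : ℝ
  /-- cutting cost of the B-size -/
  κB : ℝ
  /-- cutting cost of the first-order size -/
  κN : ℝ
  /-- cutting cost of the |·|_{(−3)}-size -/
  κ3 : ℝ
  /-- row-sum constant of Lemma 2.1 [3] at rate ⅛δ₀ -/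
  c61 : ℝ
  /-- kernel letter of G̃ into the first-order size -/
  BG : ℝ
  /-- kernel letter of G̃ into the output sizes of (190) -/
  BG₂ : ℝ
  /-- kernel letter of (189) -/
  θW : ℝ
  /-- kernel letter of Δ⁽²⁾H₀ ((130)) -/
  cΔ : ℝ
  /-- kernel letter of H₀ into the first-order size -/
  A₀ : ℝ
  /-- kernel letter of H₀ into the output sizes -/
  A₀₂ : ℝ
  /-- kernel letter of H into the output sizes ((137)–(139)) -/
  AH₂ : ℝ
  /-- kernel letter of 𝔇 ((73)) -/
  θD : ℝ

namespace GConsts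

variable (q : GConsts)

/-- The sign conditions on the shared constants, `C₁, a₃, A₀₂ > 0`, and the LOCATED smallness of (187): *«for ε₁ sufficiently small, hence
the norm of the linear operator is small also»* in the block-majorant form `q = κ_N·θ_K·c < 1` of `B11SectG.qG` (cell SMALLNESS S-B11.G).
[cite: Balaban1985Variational, (187) p.308] -/
structure Valid : Prop where
  C₁_pos : 0 < q.C₁
  δ₀_nonneg : 0 ≤ q.δ₀
  B₀_nonneg : 0 ≤ q.B₀
  C₄_nonneg : 0 ≤ q.C₄
  a₃_pos : 0 < q.a₃
  AH0_nonneg : 0 ≤ q.AH0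
  θ₂_nonneg : 0 ≤ q.θ₂
  AH_nonneg : 0 ≤ q.AH
  C₂_nonneg : 0 ≤ q.C₂
  κB_nonneg : 0 ≤ q.κB
  κN_nonneg : 0 ≤ q.κN
  κ3_nonneg : 0 ≤ q.κ3
  c61_nonneg : 0 ≤ q.c61
  BG_nonneg : 0 ≤ q.BG
  BG₂_nonneg : 0 ≤ q.BG₂
  θW_nonneg : 0 ≤ q.θW
  cΔ_nonneg : 0 ≤ q.cΔ
  A₀_nonneg : 0 ≤ q.A₀
  A₀₂_pos : 0 < q.A₀₂
  AH₂_nonneg : 0 ≤ q.AH₂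
  θD_nonneg : 0 ≤ q.θD
  q_lt_one : qG q.κ3 q.κN q.BG q.θW q.c61 < 1

/-- α = 2·AH0·C₁ + 1: for |B| < 2C₁ε₁ ((172)) one has ‖H₀B‖ < αε₁ — the radius `a` of the datum 𝔄 = H₀B in the regime (117)–(121).
[cite: Balaban1985Variational, (172) p.305, (180) p.306] -/
def alpha : ℝ := 2 * q.AH0 * q.C₁ + 1

/-- ι = (θ₂ + 1)·α: ‖Δ⁽²⁾H₀B‖ < ιε₁ — the bound `j` of the source J = −Δ⁽²⁾H₀B of (180). [cite: Balaban1985Variational, (180) p.306] -/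
def jcoef : ℝ := (q.θ₂ + 1) * q.alpha

/-- λ = 2B₀ι + 1: the radius ε₄ = λε₁ of the space (115) in which (180) is solved for data of size ε₁ (print, p. 305: *«the regularity
conditions (19) with ε₂ = 8B₅ε₁»*). [cite: Balaban1985Variational, (115) p.294, p.305] -/
def lam : ℝ := 2 * q.B₀ * q.jcoef + 1

/-- S = λ + α: ‖𝒜₀ + H₀B‖ < Sε₁. [cite: Balaban1985Variational, (179) p.306] -/
def S : ℝ := q.lam + q.alpha

/-- **B₅ of the model**: ε₂ = B₅ε₁ in «𝓗 satisfies the conditions (19)–(21) with ε₂ = B₅ε₁» read in the norm of (115), B₅ = 2(λ + α)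
(reading (R5); print's (173) has B₅ = 6B₁B₃C₁). [cite: Balaban1985Variational, (173) p.305, Prop. 9 p.309] -/
def B5 : ℝ := 2 * q.S

/-- **«for ε₁ sufficiently small»** made explicit: the five members guarantee (i) the domain condition 2(ε₄ + a) ≤ a₃ of (121), (ii) the
self-map condition (118), (iii) the contraction condition (121), (iv) C₁ε₁ ≤ ½ for (172), (v) 16·AH·C₂·Sε₁ ≤ 1 for the (19)-bound via (55).
[cite: Balaban1985Variational, (118)–(121) p.295, (172) p.305] -/
def cthr : ℝ :=
  min (min (q.a₃ / (2 * q.S)) (1 / (q.B₀ * q.C₄ * q.S ^ 2 + 1)))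
    (min (1 / (4 * q.B₀ * q.C₄ * q.S + 1)) (min (1 / (2 * q.C₁ + 1)) (1 / (16 * q.AH * q.C₂ * q.S + 1))))

/-- **The fixed radius of (115) at which the chart is taken**: ε⋆ = λ·cthr (admissible for every ε₁ ≤ cthr; the chart does not depend on
the auxiliary radius, `B11Eq174Chart.Regime.chartH_eq_of_le`). [cite: Balaban1985Variational, (115) p.294, Prop. 6 p.295] -/
def epsStar : ℝ := q.lam * q.cthr

/-- The majorant constant of 𝔄₀ = (δ/δB)𝒜₀ into the first-order size (`B11SectG.constA0`). [cite: Balaban1985Variational, (188)–(190) p.308] -/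
def CA0 : ℝ := constA0 q.κ3 q.κN q.BG q.θW q.cΔ q.A₀ q.c61

/-- The majorant constant of 𝔄₀ into the output sizes (`B11SectG.A0_strong_of_184`). [cite: Balaban1985Variational, (184)–(190) pp.307–308] -/
def CA0₂ : ℝ := q.κ3 * q.BG₂ * (q.cΔ + q.κN * q.θW * (q.A₀ + q.CA0) * q.c61) * q.c61

/-- **The O(1) of (190)** — explicit: `(CA0₂ + A₀₂) + κB·AH₂·(κN·θD·(CA0 + A₀)·c)·c` (`B11SectG.dH_majorant_of_182`).
[cite: Balaban1985Variational, (190) p.308] -/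
def O1 : ℝ := (q.CA0₂ + q.A₀₂) + q.κB * q.AH₂ * (q.κN * q.θD * (q.CA0 + q.A₀) * q.c61) * q.c61

variable {q}

/-- α ≥ 1. [cite: Balaban1985Variational, (172) p.305] -/
theorem one_le_alpha (hq : q.Valid) : 1 ≤ q.alpha := by
  unfold alpha; nlinarith [hq.AH0_nonneg, hq.C₁_pos]

/-- α > 0. [cite: Balaban1985Variational, (172) p.305] -/
theorem alpha_pos (hq : q.Valid) : 0 < q.alpha := lt_of_lt_of_le one_pos (one_le_alpha hq)

/-- ι > 0. [cite: Balaban1985Variational, (180) p.306] -/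
theorem jcoef_pos (hq : q.Valid) : 0 < q.jcoef := by
  unfold jcoef; exact mul_pos (by linarith [hq.θ₂_nonneg]) (alpha_pos hq)

/-- λ ≥ 1. [cite: Balaban1985Variational, (115) p.294] -/
theorem one_le_lam (hq : q.Valid) : 1 ≤ q.lam := by
  unfold lam; nlinarith [hq.B₀_nonneg, (jcoef_pos hq).le]

/-- λ > 0. [cite: Balaban1985Variational, (115) p.294] -/
theorem lam_pos (hq : q.Valid) : 0 < q.lam := lt_of_lt_of_le one_pos (one_le_lam hq)

/-- S > 0. [cite: Balaban1985Variational, (179) p.306] -/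
theorem S_pos (hq : q.Valid) : 0 < q.S := by
  unfold S; exact add_pos (lam_pos hq) (alpha_pos hq)

/-- B₅ > 0. [cite: Balaban1985Variational, (173) p.305] -/
theorem B5_pos (hq : q.Valid) : 0 < q.B5 := by
  unfold B5; linarith [S_pos hq]

/-- cthr > 0. [cite: Balaban1985Variational, Prop. 9 p.309] -/
theorem cthr_pos (hq : q.Valid) : 0 < q.cthr := by
  have hS := S_pos hq
  have h1 : 0 < q.B₀ * q.C₄ * q.S ^ 2 + 1 := by nlinarith [hq.B₀_nonneg, hq.C₄_nonneg, sq_nonneg q.S, mul_nonneg hq.B₀_nonneg hq.C₄_nonneg]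
  have h2 : 0 < 4 * q.B₀ * q.C₄ * q.S + 1 := by nlinarith [mul_nonneg (mul_nonneg hq.B₀_nonneg hq.C₄_nonneg) hS.le]
  have h3 : 0 < 2 * q.C₁ + 1 := by linarith [hq.C₁_pos]
  have h4 : 0 < 16 * q.AH * q.C₂ * q.S + 1 := by nlinarith [mul_nonneg (mul_nonneg hq.AH_nonneg hq.C₂_nonneg) hS.le]
  unfold cthr
  exact lt_min (lt_min (div_pos hq.a₃_pos (by linarith)) (one_div_pos.mpr h1))
    (lt_min (one_div_pos.mpr h2) (lt_min (one_div_pos.mpr h3) (one_div_pos.mpr h4)))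

/-- ε⋆ > 0. [cite: Balaban1985Variational, (115) p.294] -/
theorem epsStar_pos (hq : q.Valid) : 0 < q.epsStar := mul_pos (lam_pos hq) (cthr_pos hq)

/-- If `c ≤ 1/(K + 1)` with `K ≥ 0`, `c ≥ 0`, then `K·c ≤ 1 − c`. [folklore] -/
private theorem mul_le_of_le_inv_succ {K c : ℝ} (hK : 0 ≤ K) (hc : c ≤ 1 / (K + 1)) : K * c ≤ 1 - c := by
  have hK1 : 0 < K + 1 := by linarith
  have h := (le_div_iff₀ hK1).1 hc
  nlinarith

/-- (i) the domain condition of (121): 2S·cthr ≤ a₃. [cite: Balaban1985Variational, (121) p.295] -/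
theorem two_S_cthr_le (hq : q.Valid) : 2 * q.S * q.cthr ≤ q.a₃ := by
  have hS := S_pos hq
  have h : q.cthr ≤ q.a₃ / (2 * q.S) := le_trans (min_le_left _ _) (min_le_left _ _)
  have := (le_div_iff₀ (by linarith : (0:ℝ) < 2 * q.S)).1 h
  linarith

/-- (ii) the quadratic member of (118): B₀C₄S²·cthr ≤ 1. [cite: Balaban1985Variational, (118) p.295] -/
theorem quad_cthr_le (hq : q.Valid) : q.B₀ * q.C₄ * q.S ^ 2 * q.cthr ≤ 1 := by
  have hK : 0 ≤ q.B₀ * q.C₄ * q.S ^ 2 := by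
    have := hq.B₀_nonneg; have := hq.C₄_nonneg; positivity
  have h : q.cthr ≤ 1 / (q.B₀ * q.C₄ * q.S ^ 2 + 1) := le_trans (min_le_left _ _) (min_le_right _ _)
  have := mul_le_of_le_inv_succ hK h
  linarith [(cthr_pos hq).le]

/-- (iii) the contraction member of (121): 4B₀C₄S·cthr < 1. [cite: Balaban1985Variational, (121) p.295] -/
theorem contr_cthr_lt (hq : q.Valid) : 4 * q.B₀ * q.C₄ * q.S * q.cthr < 1 := by
  have hK : 0 ≤ 4 * q.B₀ * q.C₄ * q.S := by
    have := hq.B₀_nonneg; have := hq.C₄_nonneg; have := (S_pos hq).le; positivity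
  have h : q.cthr ≤ 1 / (4 * q.B₀ * q.C₄ * q.S + 1) := le_trans (min_le_right _ _) (min_le_left _ _)
  have := mul_le_of_le_inv_succ hK h
  linarith [cthr_pos hq]

/-- (iv) (172): C₁·cthr ≤ ½. [cite: Balaban1985Variational, (172) p.305] -/
theorem C₁_cthr_le (hq : q.Valid) : q.C₁ * q.cthr ≤ 1 / 2 := by
  have h : q.cthr ≤ 1 / (2 * q.C₁ + 1) := le_trans (min_le_right _ _) (le_trans (min_le_right _ _) (min_le_left _ _))
  have := mul_le_of_le_inv_succ (K := 2 * q.C₁) (by linarith [hq.C₁_pos]) h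
  linarith [(cthr_pos hq).le]

/-- (v) the (55)-member: 16·AH·C₂·S·cthr ≤ 1. [cite: Balaban1985Variational, (55) p.286] -/
theorem D_cthr_le (hq : q.Valid) : 16 * q.AH * q.C₂ * q.S * q.cthr ≤ 1 := by
  have hK : 0 ≤ 16 * q.AH * q.C₂ * q.S := by
    have := hq.AH_nonneg; have := hq.C₂_nonneg; have := (S_pos hq).le; positivity
  have h : q.cthr ≤ 1 / (16 * q.AH * q.C₂ * q.S + 1) :=
    le_trans (min_le_right _ _) (le_trans (min_le_right _ _) (min_le_right _ _))
  have := mul_le_of_le_inv_succ hK h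
  linarith [(cthr_pos hq).le]

/-- CA0 ≥ 0 (under the smallness q < 1). [cite: Balaban1985Variational, (188)–(190) p.308] -/
theorem CA0_nonneg (hq : q.Valid) : 0 ≤ q.CA0 :=
  constA0_nonneg hq.κ3_nonneg hq.κN_nonneg hq.BG_nonneg hq.θW_nonneg hq.cΔ_nonneg hq.A₀_nonneg hq.c61_nonneg hq.q_lt_one

/-- CA0₂ ≥ 0. [cite: Balaban1985Variational, (184)–(190) pp.307–308] -/
theorem CA0₂_nonneg (hq : q.Valid) : 0 ≤ q.CA0₂ := by
  unfold CA0₂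
  have := CA0_nonneg hq; have := hq.κ3_nonneg; have := hq.κN_nonneg; have := hq.BG₂_nonneg; have := hq.θW_nonneg
  have := hq.cΔ_nonneg; have := hq.A₀_nonneg; have := hq.c61_nonneg
  positivity

/-- O1 > 0. [cite: Balaban1985Variational, (190) p.308] -/
theorem O1_pos (hq : q.Valid) : 0 < q.O1 := by
  unfold O1
  have := CA0_nonneg hq; have := CA0₂_nonneg hq; have := hq.κB_nonneg; have := hq.κN_nonneg; have := hq.AH₂_nonneg
  have := hq.θD_nonneg; have := hq.A₀_nonneg; have := hq.c61_nonneg; have := hq.A₀₂_pos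
  positivity

section RegimeArith

variable {𝒴 𝒵 : Type} [NormedAddCommGroup 𝒴] [NormedSpace ℂ 𝒴] [NormedAddCommGroup 𝒵] [NormedSpace ℂ 𝒵]
  {𝒢 : 𝒵 →L[ℂ] 𝒴} {W : 𝒴 → 𝒵}

/-- **The regime (117)–(121) of Proposition 6 at the data of (180), at the fixed radius ε⋆** — for EVERY 0 < ε₁ ≤ cthr: with ‖G̃f‖ ≤ B₀‖f‖
and Proposition 4 for W = (δ/δA′)V, the source bound j = ιε₁ and the shift radius a = αε₁, `B11Eq174Chart.Regime 𝒢 0 W B₀ 0 C₄ a₃ (ιε₁)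
(αε₁) ε⋆` holds (domain, self-map (118) and contraction (121) by the members (i)–(iii) of `cthr`).
[cite: Balaban1985Variational, (117)–(121) p.295, (180) p.306] -/
theorem regime_star (hq : q.Valid) (hG : ∀ f, ‖𝒢 f‖ ≤ q.B₀ * ‖f‖) (hW : Prop4Hyp W q.C₄ q.a₃) {ε₁ : ℝ}
    (hε₁ : 0 < ε₁) (hε : ε₁ ≤ q.cthr) :
    Regime 𝒢 0 W q.B₀ 0 q.C₄ q.a₃ (q.jcoef * ε₁) (q.alpha * ε₁) q.epsStar := by
  have hα := alpha_pos hq; have hlam := lam_pos hq; have hS := S_pos hq; have hc := cthr_pos hq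
  have hj := jcoef_pos hq
  have h1 := two_S_cthr_le hq; have h2 := quad_cthr_le hq; have h3 := contr_cthr_lt hq
  have hBC : 0 ≤ q.B₀ * q.C₄ := mul_nonneg hq.B₀_nonneg hq.C₄_nonneg
  -- ε⋆ + αε₁ ≤ S·cthr
  have hsum : q.epsStar + q.alpha * ε₁ ≤ q.S * q.cthr := by
    unfold epsStar S; nlinarith
  have hsum0 : 0 ≤ q.epsStar + q.alpha * ε₁ := by
    have := epsStar_pos hq; positivity
  refine ⟨hG, fun Y => by simp, hW.quadAnalytic, hq.B₀_nonneg, hq.C₄_nonneg, le_rfl, (epsStar_pos hq).le, ?_, ?_, ?_⟩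
  · -- dom: 2(ε⋆ + αε₁) ≤ 2S·cthr ≤ a₃
    nlinarith
  · -- self: B₀·ιε₁ + B₀C₄(ε⋆ + αε₁)² ≤ ε⋆ = (2B₀ι + 1)·cthr
    have hsq : (q.epsStar + q.alpha * ε₁) ^ 2 ≤ (q.S * q.cthr) ^ 2 := pow_le_pow_left₀ hsum0 hsum 2
    have hq2 : q.B₀ * q.C₄ * (q.epsStar + q.alpha * ε₁) ^ 2 ≤ q.cthr := by
      calc q.B₀ * q.C₄ * (q.epsStar + q.alpha * ε₁) ^ 2 ≤ q.B₀ * q.C₄ * (q.S * q.cthr) ^ 2 :=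
            mul_le_mul_of_nonneg_left hsq hBC
        _ = (q.B₀ * q.C₄ * q.S ^ 2 * q.cthr) * q.cthr := by ring
        _ ≤ 1 * q.cthr := mul_le_mul_of_nonneg_right h2 hc.le
        _ = q.cthr := one_mul _
    have hjε : q.B₀ * (q.jcoef * ε₁) ≤ q.B₀ * q.jcoef * q.cthr := by
      have := mul_le_mul_of_nonneg_left hε (mul_nonneg hq.B₀_nonneg hj.le)
      nlinarith
    have hE : q.epsStar = 2 * (q.B₀ * q.jcoef * q.cthr) + q.cthr := by unfold epsStar lam; ring
    rw [zero_mul, add_zero]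
    linarith [mul_nonneg (mul_nonneg hq.B₀_nonneg hj.le) hc.le]
  · -- contr: 4B₀C₄(ε⋆ + αε₁) ≤ 4B₀C₄S·cthr < 1
    have : 4 * q.B₀ * q.C₄ * (q.epsStar + q.alpha * ε₁) ≤ 4 * q.B₀ * q.C₄ * (q.S * q.cthr) :=
      mul_le_mul_of_nonneg_left hsum (by linarith [hBC])
    nlinarith

/-- **The same regime at the radius λε₁** (the smaller of the nested balls: existence in the ball of radius λε₁ and uniqueness in the ball
of radius ε⋆ select the same solution, whence ‖𝒜₀‖ ≤ λε₁ — the mechanism of *«This solution satisfies the bounds (115) with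
ε₄ = 3B₀C₁B₃ε₁»*, Prop. 6). [cite: Balaban1985Variational, Prop. 6 p.295, (118)–(121) p.295] -/
theorem regime_small (hq : q.Valid) (hG : ∀ f, ‖𝒢 f‖ ≤ q.B₀ * ‖f‖) (hW : Prop4Hyp W q.C₄ q.a₃) {ε₁ : ℝ}
    (hε₁ : 0 < ε₁) (hε : ε₁ ≤ q.cthr) :
    Regime 𝒢 0 W q.B₀ 0 q.C₄ q.a₃ (q.jcoef * ε₁) (q.alpha * ε₁) (q.lam * ε₁) := by
  have hα := alpha_pos hq; have hlam := lam_pos hq; have hS := S_pos hq; have hc := cthr_pos hq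
  have hj := jcoef_pos hq
  have h1 := two_S_cthr_le hq; have h2 := quad_cthr_le hq; have h3 := contr_cthr_lt hq
  have hBC : 0 ≤ q.B₀ * q.C₄ := mul_nonneg hq.B₀_nonneg hq.C₄_nonneg
  have hsum : q.lam * ε₁ + q.alpha * ε₁ = q.S * ε₁ := by unfold S; ring
  have hSε : q.S * ε₁ ≤ q.S * q.cthr := mul_le_mul_of_nonneg_left hε hS.le
  refine ⟨hG, fun Y => by simp, hW.quadAnalytic, hq.B₀_nonneg, hq.C₄_nonneg, le_rfl,
    mul_nonneg hlam.le hε₁.le, ?_, ?_, ?_⟩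
  · rw [hsum]; nlinarith
  · -- self: B₀ιε₁ + B₀C₄(Sε₁)² ≤ λε₁ = (2B₀ι + 1)ε₁  ⟸  B₀C₄S²ε₁ ≤ 1
    rw [zero_mul, add_zero, hsum]
    have hq2 : q.B₀ * q.C₄ * (q.S * ε₁) ^ 2 ≤ ε₁ := by
      have hstep : q.B₀ * q.C₄ * q.S ^ 2 * ε₁ ≤ 1 := by
        calc q.B₀ * q.C₄ * q.S ^ 2 * ε₁ ≤ q.B₀ * q.C₄ * q.S ^ 2 * q.cthr :=
              mul_le_mul_of_nonneg_left hε (mul_nonneg hBC (sq_nonneg _))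
          _ ≤ 1 := h2
      calc q.B₀ * q.C₄ * (q.S * ε₁) ^ 2 = (q.B₀ * q.C₄ * q.S ^ 2 * ε₁) * ε₁ := by ring
        _ ≤ 1 * ε₁ := mul_le_mul_of_nonneg_right hstep hε₁.le
        _ = ε₁ := one_mul _
    have hE : q.lam * ε₁ = 2 * (q.B₀ * (q.jcoef * ε₁)) + ε₁ := by unfold lam; ring
    rw [hE]
    linarith [mul_nonneg hq.B₀_nonneg (mul_nonneg hj.le hε₁.le)]
  · rw [hsum]
    have : 4 * q.B₀ * q.C₄ * (q.S * ε₁) ≤ 4 * q.B₀ * q.C₄ * (q.S * q.cthr) :=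
      mul_le_mul_of_nonneg_left hSε (by linarith [hBC])
    nlinarith

end RegimeArith

end GConsts

/-! ## §2 The datum of the Proposition 9 model and its Sect. G carrier -/

/-- **A datum of the Prop. 9 model** sharing the constants `q`: over a complete normed ℂ-algebra `𝔄` (the bond variables, Gᶜ ⊂ 𝔄 as in
`B11Eq172LogBound`), a finite bond set `ι` of 𝔅_k (so that `𝒳 := ι → 𝔄` with the sup norm is the space of the configurations B, V′ on
𝔅_k), complex Banach spaces `𝒴` (the space (115), norm max{|·|_{(−1)}, |∇·|_{(−2)}}) and `𝒵` (the space of |·|_{(−3)}), and a type `Bdry`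
of data V₀:
* `g` — the multiscale geometry 𝔅_k of [3] (sites y with j(y) = `g.scale y`, d(y, y′) = `g.dist`, L, η) with its letters `L_pos`,
  `eta_pos`, `tri` ((2.54) [3]), `dist_nonneg`, `rowSum` (Lemma 2.1 [3] (2.61) with the summable factor e^{−⅛δ₀d}, constant `q.c61`);
* for each V₀ the Sect. E–G scheme data at the background U_k(V₀): `𝒢` = G̃ of (143)/(180), `W` = (δ/δA′)V of (81), `D2` = Δ⁽²⁾ of
  (38)/(143), `H₀` of (129), `H` of (45)–(46), the Sect. C map `D` of (47) (so that 𝓗 = (𝒜₀ + H₀B) − HD(𝒜₀ + H₀B), (179));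
* block sizes (`B11SectG.BlockNorm`) `bB` on `ι → 𝔄` (the sup of |B| near y′), `bN` on `𝒴` (the size N of p. 308 localised to Δ̃(y)),
  `b3` on `𝒵` (|·|_{(−3)} localised), and the OUTPUT sizes `bout V₀ n β` on `𝒴`, n = 0,…,4 — the five local sizes in which (190) is read
  (scale weights (Lʲη)^{1,2,2+β,3,3} inside; the covariant second-order sizes n = 3, 4 depend on U_k(V₀)); their cutting costs are the
  shared `κB`, `κN`, `κ3` (`κB_eq`, …) and the compatibility letters `loc_le_norm` (local first-order size ≤ the norm of (115)),
  `norm_le_loc` (a B localised at y′ has sup norm ≤ its size there) hold;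
* the located analytic leaves at the background U_k(V₀) are NOT fields of the datum: they form the `Prop`-valued structure
  `SectGDatum.Letters V₀` below (the model's reading of «V₀ satisfies (7)»).
A MODEL datum: data only, no located statement is asserted. [cite: Balaban1985Variational, (172)–(190) pp.305–308, Prop. 9 p.309] -/
structure SectGDatum (q : GConsts) (𝔄 ι 𝒴 𝒵 Bdry : Type) [NormedRing 𝔄] [NormedAlgebra ℂ 𝔄] [CompleteSpace 𝔄] [Fintype ι]
    [NormedAddCommGroup 𝒴] [NormedSpace ℂ 𝒴] [CompleteSpace 𝒴] [NormedAddCommGroup 𝒵] [NormedSpace ℂ 𝒵] [CompleteSpace 𝒵] where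
  /-- the multiscale geometry 𝔅_k -/
  g : B6.Geometry
  /-- G̃ at the background U_k(V₀) -/
  𝒢 : Bdry → (𝒵 →L[ℂ] 𝒴)
  /-- (δ/δA′)V at the background U_k(V₀) -/
  W : Bdry → 𝒴 → 𝒵
  /-- Δ⁽²⁾ at the background U_k(V₀) -/
  D2 : Bdry → (𝒴 →L[ℂ] 𝒵)
  /-- H₀ of (129) -/
  H₀ : Bdry → ((ι → 𝔄) →L[ℂ] 𝒴)
  /-- H of (45)–(46) -/
  H : Bdry → ((ι → 𝔄) →L[ℂ] 𝒴)
  /-- the Sect. C map D of (47) -/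
  D : Bdry → 𝒴 → (ι → 𝔄)
  /-- the B-size -/
  bB : BlockNorm g (ι → 𝔄)
  /-- the first-order size N of p. 308 -/
  bN : BlockNorm g 𝒴
  /-- the size |·|_{(−3)} -/
  b3 : BlockNorm g 𝒵
  /-- the five output sizes of (190) -/
  bout : Bdry → Fin 5 → ℝ → BlockNorm g 𝒴
  L_pos : 0 < g.L
  eta_pos : 0 < g.eta
  tri : Triangle254 g
  dist_nonneg : ∀ a b : g.Site, 0 ≤ g.dist a b
  rowSum : RowSum g (q.δ₀ / 8) q.c61
  κB_eq : bB.κ = q.κB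
  κN_eq : bN.κ = q.κN
  κ3_eq : b3.κ = q.κ3
  loc_le_norm : ∀ (y : g.Site) (v : 𝒴), bN.loc y v ≤ ‖v‖
  norm_le_loc : ∀ (y' : g.Site) (μ : ι → 𝔄), bB.IsLoc y' μ → ‖μ‖ ≤ bB.loc y' μ

namespace SectGDatum

variable {q : GConsts} {𝔄 ι 𝒴 𝒵 Bdry : Type} [NormedRing 𝔄] [NormedAlgebra ℂ 𝔄] [CompleteSpace 𝔄] [Fintype ι]
  [NormedAddCommGroup 𝒴] [NormedSpace ℂ 𝒴] [CompleteSpace 𝒴] [NormedAddCommGroup 𝒵] [NormedSpace ℂ 𝒵] [CompleteSpace 𝒵]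
  (Δ : SectGDatum q 𝔄 ι 𝒴 𝒵 Bdry)

/-- **The located leaves at the background U_k(V₀)** — THE MODEL'S READING OF «V₀ satisfies (7)» (reading (R7): print uses (7) for V₀
only through Theorem 1 — U_k(V₀) exists, is regular and critical — which puts the operator theory of [5] at the background U_k(V₀) at one's
disposal, *«U satisfying the regularity conditions (3.35)–(3.38) [5], or (1.7)–(1.9) [6]»*, p. 309); each field a displayed statement
with constants uniform in V₀, NEVER asserted: `norm_G` (‖G̃f‖ ≤ B₀‖f‖ — (117) *«By Theorem 3.13 of [5]»* / p. 306 *«the new operator G has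
exactly the same properties as Δ_a⁻¹»*, [5] (3.42)); `quad98` / `W_analytic` (Proposition 4: (98), and *«The functional derivative of V(A′) is
an analytic function on this space»* (77), p. 292); `norm_H₀` ((129)–(130) *«we use the bound (3.133) [5]»*); `norm_D2` (Δ⁽²⁾ = the
O(|∂U₀ − 1|) part of Δ, (38)–(40)); `norm_H` ((46), [5] Thm 3.12); `D_analytic` and `norm_D` (Proposition 3: the map (47) *«is defined and
analytic for A′ satisfying (43)»* and (55) |D(A′)| ≤ 4C₂|A′|²_{(−1)}, read on the ball (77)); `maj73` ((73): *«|𝔇(A′; c, b)| ≤ O(1)C₃ε₃(Lʲη)^{−d+1}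
e^{−½δ₀d(c₋,y)}»* — the kernel of 𝔇 = (δ/δA′)D, at every A′ of (77)); **`maj189`** ((189), p. 308 — AUTHOR-OMITTED: *«We do not perform these
calculations here … let us formulate a final result only»*, cell GAPS G-B11-G2 — at every A′ of (77), *«for A′ satisfying (77)»*); `majG`,
`majG₂` (the kernel of G̃: [5] (3.42)–(3.47), p. 306, G-B11-G1; into the first-order size and into the five output sizes); `majD2H0` ((130),
p. 297: *«|(Δ_{U₀}H₀,μν)(x, y′)| ≤ B₀(Lʲη)⁻³(L^{j′}η)^{−d}e^{−δ₀d(y,y′)}»*); `majH0`, `majH0₂` ((129)–(130)); `majH₂` ((137)–(139) p. 298, G-B11-E4R).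
[cite: Balaban1985Variational, (7) p.278, (73) p.289, (98) p.293, (117) p.295, (129)–(130) p.297, (189) p.308, Prop. 9 p.309] -/
structure Letters (V₀ : Bdry) : Prop where
  norm_G : ∀ f, ‖Δ.𝒢 V₀ f‖ ≤ q.B₀ * ‖f‖
  quad98 : ∀ Y, ‖Y‖ < q.a₃ → ‖Δ.W V₀ Y‖ ≤ q.C₄ * ‖Y‖ ^ 2
  W_analytic : AnalyticOnNhd ℂ (Δ.W V₀) {Y : 𝒴 | ‖Y‖ < q.a₃}
  norm_H₀ : ∀ B, ‖Δ.H₀ V₀ B‖ ≤ q.AH0 * ‖B‖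
  norm_D2 : ∀ Y, ‖Δ.D2 V₀ Y‖ ≤ q.θ₂ * ‖Y‖
  norm_H : ∀ B, ‖Δ.H V₀ B‖ ≤ q.AH * ‖B‖
  D_analytic : AnalyticOnNhd ℂ (Δ.D V₀) {Y : 𝒴 | ‖Y‖ < q.a₃}
  norm_D : ∀ Y, ‖Y‖ < q.a₃ → ‖Δ.D V₀ Y‖ ≤ 4 * q.C₂ * ‖Y‖ ^ 2
  maj73 : ∀ Y, ‖Y‖ < q.a₃ →
    HasMaj Δ.bN Δ.bB ((fderiv ℂ (Δ.D V₀) Y).restrictScalars ℝ : 𝒴 →ₗ[ℝ] (ι → 𝔄))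
      (fun y y' => q.θD * Real.exp (-(q.δ₀ / 2 * Δ.g.dist y y')))
  maj189 : ∀ Y, ‖Y‖ < q.a₃ →
    Ineq189 Δ.bN Δ.b3 ((fderiv ℂ (Δ.W V₀) Y).restrictScalars ℝ : 𝒴 →ₗ[ℝ] 𝒵) q.θW q.δ₀
  majG : HasMaj Δ.b3 Δ.bN ((Δ.𝒢 V₀).restrictScalars ℝ : 𝒵 →ₗ[ℝ] 𝒴)
    (fun y y' => q.BG * Real.exp (-(q.δ₀ * Δ.g.dist y y')))
  majG₂ : ∀ (n : Fin 5) (β : ℝ), 0 ≤ β → β ≤ q.β₀ →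
    HasMaj Δ.b3 (Δ.bout V₀ n β) ((Δ.𝒢 V₀).restrictScalars ℝ : 𝒵 →ₗ[ℝ] 𝒴)
      (fun y y' => q.BG₂ * Real.exp (-(q.δ₀ * Δ.g.dist y y')))
  majD2H0 : HasMaj Δ.bB Δ.b3 ((Δ.D2 V₀ ∘L Δ.H₀ V₀).restrictScalars ℝ : (ι → 𝔄) →ₗ[ℝ] 𝒵)
    (fun y y' => q.cΔ * Real.exp (-(q.δ₀ * Δ.g.dist y y')))
  majH0 : HasMaj Δ.bB Δ.bN ((Δ.H₀ V₀).restrictScalars ℝ : (ι → 𝔄) →ₗ[ℝ] 𝒴)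
    (fun y y' => q.A₀ * Real.exp (-(q.δ₀ * Δ.g.dist y y')))
  majH0₂ : ∀ (n : Fin 5) (β : ℝ), 0 ≤ β → β ≤ q.β₀ →
    HasMaj Δ.bB (Δ.bout V₀ n β) ((Δ.H₀ V₀).restrictScalars ℝ : (ι → 𝔄) →ₗ[ℝ] 𝒴)
      (fun y y' => q.A₀₂ * Real.exp (-(q.δ₀ * Δ.g.dist y y')))
  majH₂ : ∀ (n : Fin 5) (β : ℝ), 0 ≤ β → β ≤ q.β₀ →
    HasMaj Δ.bB (Δ.bout V₀ n β) ((Δ.H V₀).restrictScalars ℝ : (ι → 𝔄) →ₗ[ℝ] 𝒴)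
      (fun y y' => q.AH₂ * Real.exp (-(q.δ₀ / 2 * Δ.g.dist y y')))

/-- **𝓗 in the representation (179)–(180)** at the background U_k(V₀), AS A FUNCTION OF B: `B11Eq183Differentiation.chartH179` with the
Sect. C map `A′ ↦ A′ − HD(A′)` ((47)) at the fixed radius ε⋆ of (115). [cite: Balaban1985Variational, (179)–(180) p.306, (47) p.285] -/
def chart (V₀ : Bdry) : (ι → 𝔄) → 𝒴 :=
  chartH179 (Δ.𝒢 V₀) (Δ.W V₀) (Δ.D2 V₀) (Δ.H₀ V₀) (fun Y : 𝒴 => Y - Δ.H V₀ (Δ.D V₀ Y)) q.epsStar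

/-- *«Gᶜ-valued small configurations V′ on 𝔅_k»*: `{V′ : |V′(b) − 1| < r for every bond b}` ((172) with r = C₁ε₁; reading (R1)).
[cite: Balaban1985Variational, (172) p.305, Prop. 9 p.309] -/
def smallCfg (r : ℝ) : Set (ι → 𝔄) := {V' | ∀ b, ‖V' b - 1‖ < r}

/-- B = (1/i) log V′ bondwise (the series logarithm `MatrixLog.mlog` of [4] (21), as in `B11SectGAnalyticV`).
[cite: Balaban1985Variational, (172) p.305] -/
def logCfg (V' : ι → 𝔄) : ι → 𝔄 :=
  fun b => (-Complex.I) • Literature.MathematicalPhysics.QuantumFieldTheory.Balaban1983to89.MatrixLog.mlog (V' b)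

/-- The normalised block entry at (y, y′) of a linear map T from the B-space into a size `bo` on 𝒴: the worst size near y of Tμ over the
perturbations μ of B localised at y′ with |μ|_{y′} ≤ 1 (reading (R6)). [cite: Balaban1985Variational, (190) p.308] -/
def entry (bo : BlockNorm Δ.g 𝒴) (T : (ι → 𝔄) →ₗ[ℝ] 𝒴) (y y' : Δ.g.Site) : ℝ :=
  sSup {r : ℝ | ∃ μ : ι → 𝔄, Δ.bB.IsLoc y' μ ∧ Δ.bB.loc y' μ ≤ 1 ∧ r = bo.loc y (T μ)}

/-- **The five left-hand sides of (190)** in the model (reading (R6)): `pref190(Lʲη, β)_n · (L^{j′}η)^{−d} ·` the normalised block entry at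
(y, y′) of the actual Fréchet derivative (δ/δB)𝓗(B) into the output size `bout V₀ n β`. [cite: Balaban1985Variational, (190) p.308] -/
def dHEntry (n : Fin 5) (β : ℝ) (V₀ : Bdry) (B : ι → 𝔄) (y y' : Δ.g.Site) : ℝ :=
  B11.pref190 (Δ.g.L ^ Δ.g.scale y * Δ.g.eta) β n * (Δ.g.L ^ Δ.g.scale y' * Δ.g.eta) ^ (-(q.d : ℝ)) *
    Δ.entry (Δ.bout V₀ n β) ((fderiv ℂ (Δ.chart V₀) B).restrictScalars ℝ : (ι → 𝔄) →ₗ[ℝ] 𝒴) y y'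

/-- **The Sect. G carrier `B11.AnData` of the datum** (readings (R1)–(R7) of the header): `Bdry`; `CB := ι → 𝔄` with `bnorm := ‖·‖`;
sites, scales, distance, L, η of `g`; `dim := q.d`; `Reg7 ε₁ V₀ := Letters V₀` (reading (R7)); `ExtAnalytic r V₀ :=` V′ ↦ 𝓗(B(V′)) analytic on the small
configurations of radius r; `ExtOrbits r V₀ :=` uniqueness of analytic continuation on that domain; `HDet V₀ B :=` exactly one 𝒜₀ in the
ball (115) of radius ε⋆ solves (180) and 𝓗(B) = (𝒜₀ + H₀B) − HD(𝒜₀ + H₀B) ((179)); `HAnalytic r V₀ :=` 𝓗 analytic on |B| < r;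
`HIn19_21 ε₂ V₀ B := ‖𝓗(B)‖ < ε₂`; `dH := dHEntry`. [cite: Balaban1985Variational, (170)–(190) pp.305–308, Prop. 9 p.309] -/
def toAnData : B11.AnData where
  Bdry := Bdry
  CB := ι → 𝔄
  Site := Δ.g.Site
  L := Δ.g.L
  eta := Δ.g.eta
  dim := q.d
  scale := Δ.g.scale
  sdist := Δ.g.dist
  Reg7 := fun _ V₀ => Δ.Letters V₀
  bnorm := fun B => ‖B‖
  ExtAnalytic := fun r V₀ => AnalyticOnNhd ℂ (fun V' : ι → 𝔄 => Δ.chart V₀ (logCfg V')) (smallCfg r)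
  ExtOrbits := fun r V₀ => ∀ Φ : (ι → 𝔄) → 𝒴, AnalyticOnNhd ℂ Φ (smallCfg r) →
    Φ =ᶠ[𝓝 (1 : ι → 𝔄)] (fun V' : ι → 𝔄 => Δ.chart V₀ (logCfg V')) →
      EqOn Φ (fun V' : ι → 𝔄 => Δ.chart V₀ (logCfg V')) (smallCfg r)
  HDet := fun V₀ B => ∃ 𝒜₀ : 𝒴, ‖𝒜₀‖ ≤ q.epsStar ∧
    𝒜₀ - Δ.𝒢 V₀ (Δ.D2 V₀ (Δ.H₀ V₀ B)) + Δ.𝒢 V₀ (Δ.W V₀ (𝒜₀ + Δ.H₀ V₀ B)) = 0 ∧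
    Δ.chart V₀ B = (𝒜₀ + Δ.H₀ V₀ B) - Δ.H V₀ (Δ.D V₀ (𝒜₀ + Δ.H₀ V₀ B)) ∧
    ∀ 𝒜' : 𝒴, ‖𝒜'‖ ≤ q.epsStar →
      𝒜' - Δ.𝒢 V₀ (Δ.D2 V₀ (Δ.H₀ V₀ B)) + Δ.𝒢 V₀ (Δ.W V₀ (𝒜' + Δ.H₀ V₀ B)) = 0 → 𝒜' = 𝒜₀
  HAnalytic := fun r V₀ => AnalyticOnNhd ℂ (Δ.chart V₀) (ball (0 : ι → 𝔄) r)
  HIn19_21 := fun ε₂ V₀ B => ‖Δ.chart V₀ B‖ < ε₂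
  dH := Δ.dHEntry

/-! ## §3 The clauses of Proposition 9 for the model -/

section Clauses

variable {Δ}

/-- (98) and analyticity of W = (δ/δA′)V on the ball (77) in the `AnalyticOnNhd` form of `B11Eq183Differentiation`.
[cite: Balaban1985Variational, Prop. 4 p.292] -/
theorem analyticOnNhd_W {V₀ : Bdry} (hV : Δ.Letters V₀) :
    AnalyticOnNhd ℂ (Δ.W V₀) {Y : 𝒴 | ‖Y‖ < q.a₃} :=
  hV.W_analytic

/-- Proposition 4 in the Fréchet form `B11Prop6Scheme.Prop4Hyp` (the input of `B11Eq174Chart.Regime`).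
[cite: Balaban1985Variational, Prop. 4 (98) pp.292–293] -/
theorem prop4Hyp {V₀ : Bdry} (hV : Δ.Letters V₀) : Prop4Hyp (Δ.W V₀) q.C₄ q.a₃ :=
  ⟨hV.quad98, (hV.W_analytic).differentiableOn⟩

/-- For |B| < 2C₁ε₁ ((172)): ‖H₀B‖ < αε₁. [cite: Balaban1985Variational, (172) p.305, (129)–(130) p.297] -/
theorem norm_H₀_lt (hq : q.Valid) {ε₁ : ℝ} (hε₁ : 0 < ε₁) {V₀ : Bdry} (hV : Δ.Letters V₀) {B : ι → 𝔄}
    (hB : ‖B‖ < 2 * q.C₁ * ε₁) : ‖Δ.H₀ V₀ B‖ < q.alpha * ε₁ := by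
  have h1 := hV.norm_H₀ B
  have h2 : q.AH0 * ‖B‖ ≤ q.AH0 * (2 * q.C₁ * ε₁) := mul_le_mul_of_nonneg_left hB.le hq.AH0_nonneg
  have : q.alpha * ε₁ = q.AH0 * (2 * q.C₁ * ε₁) + ε₁ := by unfold GConsts.alpha; ring
  linarith

/-- For |B| < 2C₁ε₁: ‖Δ⁽²⁾H₀B‖ < ιε₁. [cite: Balaban1985Variational, (180) p.306, (38)–(40) p.284] -/
theorem norm_D2H₀_lt (hq : q.Valid) {ε₁ : ℝ} (hε₁ : 0 < ε₁) {V₀ : Bdry} (hV : Δ.Letters V₀) {B : ι → 𝔄}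
    (hB : ‖B‖ < 2 * q.C₁ * ε₁) : ‖Δ.D2 V₀ (Δ.H₀ V₀ B)‖ < q.jcoef * ε₁ := by
  have h0 := norm_H₀_lt hq hε₁ hV hB
  have h1 := hV.norm_D2 (Δ.H₀ V₀ B)
  have h2 : q.θ₂ * ‖Δ.H₀ V₀ B‖ ≤ q.θ₂ * (q.alpha * ε₁) := mul_le_mul_of_nonneg_left h0.le hq.θ₂_nonneg
  have hα : 0 < q.alpha * ε₁ := mul_pos (GConsts.alpha_pos hq) hε₁
  have : q.jcoef * ε₁ = q.θ₂ * (q.alpha * ε₁) + q.alpha * ε₁ := by unfold GConsts.jcoef; ring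
  linarith

/-- The ball |B| < 2C₁ε₁ lies in the (open) parameter domain of (180). [cite: Balaban1985Variational, (172) p.305, (180) p.306] -/
theorem ball_subset_dom (hq : q.Valid) {ε₁ : ℝ} (hε₁ : 0 < ε₁) {V₀ : Bdry} (hV : Δ.Letters V₀) :
    ball (0 : ι → 𝔄) (2 * q.C₁ * ε₁) ⊆
      {B : ι → 𝔄 | ‖Δ.H₀ V₀ B‖ < q.alpha * ε₁ ∧ ‖Δ.D2 V₀ (Δ.H₀ V₀ B)‖ < q.jcoef * ε₁} := fun B hB => by
  rw [mem_ball_zero_iff] at hB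
  exact ⟨norm_H₀_lt hq hε₁ hV hB, norm_D2H₀_lt hq hε₁ hV hB⟩

/-- The Sect. C map `A′ ↦ A′ − HD(A′)` is analytic on the ball of radius ε⋆ + αε₁ (⊆ the ball (77), by member (i) of `cthr`).
[cite: Balaban1985Variational, (47) p.285, Prop. 3 p.289] -/
theorem analyticOnNhd_Tm (hq : q.Valid) {ε₁ : ℝ} (hε : ε₁ ≤ q.cthr) {V₀ : Bdry} (hV : Δ.Letters V₀) :
    AnalyticOnNhd ℂ (fun Y : 𝒴 => Y - Δ.H V₀ (Δ.D V₀ Y)) {Y : 𝒴 | ‖Y‖ < q.epsStar + q.alpha * ε₁} := by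
  intro Y hY
  have hS : q.epsStar + q.alpha * ε₁ < q.a₃ := by
    have h1 := GConsts.two_S_cthr_le hq
    have hα := GConsts.alpha_pos hq
    have : q.epsStar + q.alpha * ε₁ ≤ q.S * q.cthr := by
      unfold GConsts.epsStar GConsts.S; nlinarith
    linarith [hq.a₃_pos]
  have hYa : ‖Y‖ < q.a₃ := lt_trans hY hS
  have hD : AnalyticAt ℂ (Δ.D V₀) Y := hV.D_analytic Y hYa
  exact analyticAt_id.sub (((Δ.H V₀).analyticAt _).comp hD)

/-- **«The function 𝓗(B) is determined by Eqs. (179), (180)»**: for |B| < 2C₁ε₁, 0 < ε₁ ≤ cthr and V₀ with (7), there is EXACTLY ONE 𝒜₀ in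
the ball (115) of radius ε⋆ solving (180), and 𝓗(B) = (𝒜₀ + H₀B) − HD(𝒜₀ + H₀B). [cite: Balaban1985Variational, (179)–(180) p.306, Prop. 9 p.309] -/
theorem hDet_model (hq : q.Valid) {ε₁ : ℝ} (hε₁ : 0 < ε₁) (hε : ε₁ ≤ q.cthr) {V₀ : Bdry} (hV : Δ.Letters V₀)
    {B : ι → 𝔄} (hB : ‖B‖ < 2 * q.C₁ * ε₁) : Δ.toAnData.HDet V₀ B := by
  dsimp only [toAnData]
  have R := GConsts.regime_star hq (hV.norm_G) (prop4Hyp hV) hε₁ hε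
  have h𝔄 := norm_H₀_lt hq hε₁ hV hB
  have hJ := norm_D2H₀_lt hq hε₁ hV hB
  obtain ⟨heq, hnorm⟩ := eq180 R hJ.le h𝔄
  refine ⟨solA180 (Δ.𝒢 V₀) (Δ.W V₀) (Δ.D2 V₀) (Δ.H₀ V₀) q.epsStar B, hnorm, heq, rfl, fun 𝒜' h𝒜' heq' => ?_⟩
  rw [solA180_def]
  refine R.eq_solA (J := -(Δ.D2 V₀ (Δ.H₀ V₀ B))) (by rw [norm_neg]; exact hJ.le) h𝔄 h𝒜' ?_
  rw [mapT_180]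
  calc Δ.𝒢 V₀ (Δ.D2 V₀ (Δ.H₀ V₀ B)) - Δ.𝒢 V₀ (Δ.W V₀ (𝒜' + Δ.H₀ V₀ B))
      = 𝒜' - (𝒜' - Δ.𝒢 V₀ (Δ.D2 V₀ (Δ.H₀ V₀ B)) + Δ.𝒢 V₀ (Δ.W V₀ (𝒜' + Δ.H₀ V₀ B))) := by abel
    _ = 𝒜' := by rw [heq', sub_zero]

/-- **«It is an analytic function of B»** on the ball |B| < 2C₁ε₁ of (172). [cite: Balaban1985Variational, Prop. 9 p.309, p.306] -/
theorem hAnalytic_model (hq : q.Valid) {ε₁ : ℝ} (hε₁ : 0 < ε₁) (hε : ε₁ ≤ q.cthr) {V₀ : Bdry} (hV : Δ.Letters V₀) :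
    Δ.toAnData.HAnalytic (2 * q.C₁ * ε₁) V₀ := by
  dsimp only [toAnData]
  have R := GConsts.regime_star hq (hV.norm_G) (prop4Hyp hV) hε₁ hε
  exact (analyticOnNhd_chartH179 R (analyticOnNhd_W hV) (analyticOnNhd_Tm hq hε hV)).mono
    (ball_subset_dom hq hε₁ hV)

/-- **«It satisfies the conditions (19)–(21) with ε₂ = B₅ε₁»** in the norm of (115) (reading (R5)): for |B| < 2C₁ε₁, ‖𝓗(B)‖ < B₅ε₁, B₅ =
2(λ + α) — from ‖𝒜₀‖ ≤ λε₁ (the nested radii λε₁ ≤ ε⋆), ‖H₀B‖ < αε₁, and |HD(A′)| ≤ AH·4C₂|A′|² ≤ |A′| on that ball ((55), member (v) of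
`cthr`). [cite: Balaban1985Variational, (173) p.305, (19) p.281, (55) p.286, Prop. 9 p.309] -/
theorem norm_chart_lt (hq : q.Valid) {ε₁ : ℝ} (hε₁ : 0 < ε₁) (hε : ε₁ ≤ q.cthr) {V₀ : Bdry} (hV : Δ.Letters V₀)
    {B : ι → 𝔄} (hB : ‖B‖ < 2 * q.C₁ * ε₁) : ‖Δ.chart V₀ B‖ < q.B5 * ε₁ := by
  have R := GConsts.regime_star hq (hV.norm_G) (prop4Hyp hV) hε₁ hε
  have R' := GConsts.regime_small hq (hV.norm_G) (prop4Hyp hV) hε₁ hε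
  have h𝔄 := norm_H₀_lt hq hε₁ hV hB
  have hJ := norm_D2H₀_lt hq hε₁ hV hB
  have hJ' : ‖-(Δ.D2 V₀ (Δ.H₀ V₀ B))‖ ≤ q.jcoef * ε₁ := by rw [norm_neg]; exact hJ.le
  have hle : q.lam * ε₁ ≤ q.epsStar := by
    unfold GConsts.epsStar; exact mul_le_mul_of_nonneg_left hε (GConsts.lam_pos hq).le
  -- ‖𝒜₀‖ ≤ λε₁ by the nested radii
  set 𝒜₀ := solA180 (Δ.𝒢 V₀) (Δ.W V₀) (Δ.D2 V₀) (Δ.H₀ V₀) q.epsStar B with h𝒜₀def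
  have h𝒜₀ : ‖𝒜₀‖ ≤ q.lam * ε₁ := by
    rw [h𝒜₀def, solA180_def, ← R.solA_eq_of_le R' hle hJ' h𝔄]
    exact (R'.solA_mem hJ' h𝔄).1
  have hY : ‖𝒜₀ + Δ.H₀ V₀ B‖ < q.S * ε₁ := by
    have := norm_arg_lt h𝔄 h𝒜₀
    have e : q.lam * ε₁ + q.alpha * ε₁ = q.S * ε₁ := by unfold GConsts.S; ring
    linarith
  have hS := GConsts.S_pos hq
  have hSε : q.S * ε₁ ≤ q.S * q.cthr := mul_le_mul_of_nonneg_left hε hS.le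
  have hYa : ‖𝒜₀ + Δ.H₀ V₀ B‖ < q.a₃ := by
    have := GConsts.two_S_cthr_le hq; linarith [hq.a₃_pos]
  -- (55): ‖HD(Y)‖ ≤ AH·4C₂‖Y‖² ≤ ‖Y‖
  have hD := hV.norm_D _ hYa
  have hHD : ‖Δ.H V₀ (Δ.D V₀ (𝒜₀ + Δ.H₀ V₀ B))‖ ≤ q.AH * (4 * q.C₂ * ‖𝒜₀ + Δ.H₀ V₀ B‖ ^ 2) :=
    (hV.norm_H _).trans (mul_le_mul_of_nonneg_left hD hq.AH_nonneg)
  have hsmall : q.AH * (4 * q.C₂ * ‖𝒜₀ + Δ.H₀ V₀ B‖ ^ 2) ≤ ‖𝒜₀ + Δ.H₀ V₀ B‖ := by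
    have h5 := GConsts.D_cthr_le hq
    have hn : 0 ≤ ‖𝒜₀ + Δ.H₀ V₀ B‖ := norm_nonneg _
    have hAC : 0 ≤ q.AH * q.C₂ := mul_nonneg hq.AH_nonneg hq.C₂_nonneg
    have h6 : 4 * q.AH * q.C₂ * ‖𝒜₀ + Δ.H₀ V₀ B‖ ≤ 4 * q.AH * q.C₂ * (q.S * q.cthr) :=
      mul_le_mul_of_nonneg_left (hY.le.trans hSε) (by linarith [hAC])
    nlinarith [mul_le_mul_of_nonneg_right h6 hn, mul_le_mul_of_nonneg_right h5 hn]
  have hrepr : Δ.chart V₀ B = (𝒜₀ + Δ.H₀ V₀ B) - Δ.H V₀ (Δ.D V₀ (𝒜₀ + Δ.H₀ V₀ B)) := rfl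
  rw [hrepr]
  have e : q.B5 * ε₁ = 2 * (q.S * ε₁) := by unfold GConsts.B5; ring
  calc ‖(𝒜₀ + Δ.H₀ V₀ B) - Δ.H V₀ (Δ.D V₀ (𝒜₀ + Δ.H₀ V₀ B))‖
      ≤ ‖𝒜₀ + Δ.H₀ V₀ B‖ + ‖Δ.H V₀ (Δ.D V₀ (𝒜₀ + Δ.H₀ V₀ B))‖ := norm_sub_le _ _
    _ ≤ ‖𝒜₀ + Δ.H₀ V₀ B‖ + ‖𝒜₀ + Δ.H₀ V₀ B‖ := by linarith
    _ < q.B5 * ε₁ := by rw [e]; linarith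

/-- The typed clause: `HIn19_21 (B₅ε₁) V₀ B`. [cite: Balaban1985Variational, Prop. 9 p.309] -/
theorem hIn19_21_model (hq : q.Valid) {ε₁ : ℝ} (hε₁ : 0 < ε₁) (hε : ε₁ ≤ q.cthr) {V₀ : Bdry} (hV : Δ.Letters V₀)
    {B : ι → 𝔄} (hB : ‖B‖ < 2 * q.C₁ * ε₁) {B₅ : ℝ} (hB₅ : q.B5 ≤ B₅) : Δ.toAnData.HIn19_21 (B₅ * ε₁) V₀ B := by
  show ‖Δ.chart V₀ B‖ < B₅ * ε₁
  exact lt_of_lt_of_le (norm_chart_lt hq hε₁ hε hV hB) (mul_le_mul_of_nonneg_right hB₅ hε₁.le)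

/-- **«has an extension to an analytic function of Gᶜ-valued small configurations V′ on 𝔅_k»** (reading (R2)): V′ ↦ 𝓗(B(V′)),
B(V′) = (1/i) log V′, is analytic on {|V′ − 1| < C₁ε₁} — the chart is analytic on |B| < 2C₁ε₁ and (172) maps the small configurations
there (`B11SectGAnalyticV.analyticOnNhd_comp_logCfg_ball`, C₁ε₁ ≤ ½ by member (iv) of `cthr`).
[cite: Balaban1985Variational, (172) p.305, p.307, Prop. 9 p.309] -/
theorem extAnalytic_model (hq : q.Valid) {ε₁ : ℝ} (hε₁ : 0 < ε₁) (hε : ε₁ ≤ q.cthr) {V₀ : Bdry} (hV : Δ.Letters V₀) :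
    Δ.toAnData.ExtAnalytic (q.C₁ * ε₁) V₀ := by
  dsimp only [toAnData, logCfg, smallCfg]
  have hH : AnalyticOnNhd ℂ (Δ.chart V₀) (ball (0 : ι → 𝔄) (2 * (q.C₁ * ε₁))) := by
    have h := hAnalytic_model (Δ := Δ) hq hε₁ hε hV
    dsimp only [toAnData] at h
    rw [mul_assoc] at h
    exact h
  have hs : q.C₁ * ε₁ ≤ 1 / 2 :=
    le_trans (mul_le_mul_of_nonneg_left hε hq.C₁_pos.le) (GConsts.C₁_cthr_le hq)
  have hpos : 0 < q.C₁ * ε₁ := mul_pos hq.C₁_pos hε₁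
  exact B11SectGAnalyticV.analyticOnNhd_comp_logCfg_ball hH hs hpos le_rfl

omit [CompleteSpace 𝔄] [Fintype ι] in
/-- The set of small configurations is convex. [folklore] -/
private theorem convex_smallCfg (r : ℝ) : Convex ℝ (smallCfg r : Set (ι → 𝔄)) := by
  intro x hx y hy a b ha hb hab i
  have hx' := hx i
  have hy' := hy i
  have e : (a • x + b • y) i - 1 = a • (x i - 1) + b • (y i - 1) := by
    have h1 : (a • x + b • y) i = a • x i + b • y i := rfl
    rw [h1, smul_sub, smul_sub, ← add_sub_add_comm]
    have : a • (1 : 𝔄) + b • (1 : 𝔄) = 1 := by rw [← add_smul, hab, one_smul]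
    rw [this]
  rw [e]
  rcases ha.eq_or_lt with rfl | ha'
  · simp only [zero_smul, zero_add] at hab ⊢
    rw [hab, one_smul]; exact hy'
  · calc ‖a • (x i - 1) + b • (y i - 1)‖ ≤ ‖a • (x i - 1)‖ + ‖b • (y i - 1)‖ := norm_add_le _ _
      _ = a * ‖x i - 1‖ + b * ‖y i - 1‖ := by
          rw [norm_smul, norm_smul, Real.norm_of_nonneg ha, Real.norm_of_nonneg hb]
      _ < a * r + b * r := by
          have h1 : a * ‖x i - 1‖ < a * r := mul_lt_mul_of_pos_left hx' ha'
          have h2 : b * ‖y i - 1‖ ≤ b * r := mul_le_mul_of_nonneg_left hy'.le hb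
          linarith
      _ = r := by rw [← add_mul, hab, one_mul]

/-- **«It can be extended further … by the equality (181)» — the mechanism** (reading (R3)): on the domain {|V′ − 1| < C₁ε₁} (open,
convex, ∋ 1) an analytic function agreeing with V′ ↦ 𝓗(B(V′)) near V′ = 1 agrees with it everywhere (uniqueness of analytic
continuation; the G → Gᶜ real-slice step is `B11Eq181AnalyticExtension.eq181_extends_by_analyticity`).
[cite: Balaban1985Variational, (181) p.307, Prop. 9 p.309] -/
theorem extOrbits_model (hq : q.Valid) {ε₁ : ℝ} (hε₁ : 0 < ε₁) (hε : ε₁ ≤ q.cthr) {V₀ : Bdry} (hV : Δ.Letters V₀) :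
    Δ.toAnData.ExtOrbits (q.C₁ * ε₁) V₀ := by
  dsimp only [toAnData]
  intro Φ hΦ hagree
  have hH : AnalyticOnNhd ℂ (fun V' : ι → 𝔄 => Δ.chart V₀ (logCfg V')) (smallCfg (q.C₁ * ε₁)) :=
    extAnalytic_model hq hε₁ hε hV
  have h1 : (1 : ι → 𝔄) ∈ (smallCfg (q.C₁ * ε₁) : Set (ι → 𝔄)) := by
    intro b
    simpa using mul_pos hq.C₁_pos hε₁
  exact hΦ.eqOn_of_preconnected_of_eventuallyEq hH (convex_smallCfg (𝔄 := 𝔄) (ι := ι) (q.C₁ * ε₁)).isPreconnected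
    h1 hagree

/-- **(190) for the ACTUAL derivative (δ/δB)𝓗(B) into every output size, constant `O1`** — the chain of `B11SectG` ((189) + (188) +
Lemma 2.1 ⇒ 𝔄₀ decays at rate ⅛δ₀; one more use of (184) into the output size; (182) transports) at the actual derivatives
(`B11Eq183Differentiation.eq184_sectG` / `eq182_sectG` / `bound188_sectG`), for |B| < 2C₁ε₁, 0 < ε₁ ≤ cthr, V₀ with (7), n = 0,…,4,
0 ≤ β ≤ β₀. [cite: Balaban1985Variational, (182)–(190) pp.307–308, Prop. 9 p.309] -/
theorem ineq190_model (hq : q.Valid) {ε₁ : ℝ} (hε₁ : 0 < ε₁) (hε : ε₁ ≤ q.cthr) {V₀ : Bdry} (hV : Δ.Letters V₀)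
    {B : ι → 𝔄} (hB : ‖B‖ < 2 * q.C₁ * ε₁) {n : Fin 5} {β : ℝ} (hβ0 : 0 ≤ β) (hβ : β ≤ q.β₀) :
    Ineq190 Δ.bB (Δ.bout V₀ n β) ((fderiv ℂ (Δ.chart V₀) B).restrictScalars ℝ : (ι → 𝔄) →ₗ[ℝ] 𝒴) q.O1 q.δ₀ := by
  have R := GConsts.regime_star hq (hV.norm_G) (prop4Hyp hV) hε₁ hε
  have hWa := analyticOnNhd_W (Δ := Δ) hV
  have h𝔄 := norm_H₀_lt hq hε₁ hV hB
  have hJ := norm_D2H₀_lt hq hε₁ hV hB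
  -- the point A′ = 𝒜₀(B) + H₀B of (77)
  have hY₀ : ‖solA180 (Δ.𝒢 V₀) (Δ.W V₀) (Δ.D2 V₀) (Δ.H₀ V₀) q.epsStar B + Δ.H₀ V₀ B‖ < q.a₃ :=
    norm_arg180_lt R hJ.le h𝔄
  -- 𝔇 = (δ/δA′)D at the point, with its (73)-majorant
  have hD𝔇 : HasFDerivAt (Δ.D V₀)
      (fderiv ℂ (Δ.D V₀) (solA180 (Δ.𝒢 V₀) (Δ.W V₀) (Δ.D2 V₀) (Δ.H₀ V₀) q.epsStar B + Δ.H₀ V₀ B))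
      (solA180 (Δ.𝒢 V₀) (Δ.W V₀) (Δ.D2 V₀) (Δ.H₀ V₀) q.epsStar B + Δ.H₀ V₀ B) :=
    ((hV.D_analytic) _ hY₀).differentiableAt.hasFDerivAt
  have h73 := hV.maj73 _ hY₀
  have h189 := hV.maj189 _ hY₀
  have h184 := eq184_sectG R hWa hJ h𝔄
  have h188 := bound188_sectG R hWa hJ h𝔄 Δ.loc_le_norm Δ.norm_le_loc
  have h182 := eq182_sectG R hWa hJ h𝔄 (Δ.H V₀) hD𝔇
  have hM₀ := M0_sectG_nonneg R hWa hJ h𝔄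
  have hq' : qG Δ.b3.κ Δ.bN.κ q.BG q.θW q.c61 < 1 := by rw [Δ.κ3_eq, Δ.κN_eq]; exact hq.q_lt_one
  have hA0 := A0_majorant_of_189 Δ.tri Δ.dist_nonneg hq.δ₀_nonneg Δ.rowSum hq.c61_nonneg hq.BG_nonneg hq.θW_nonneg
    hq.cΔ_nonneg hq.A₀_nonneg hM₀ (hV.majG) h189 (hV.majD2H0) (hV.majH0) h184 h188 hq'
  have hCA : 0 ≤ constA0 Δ.b3.κ Δ.bN.κ q.BG q.θW q.cΔ q.A₀ q.c61 :=
    constA0_nonneg Δ.b3.κ_nonneg Δ.bN.κ_nonneg hq.BG_nonneg hq.θW_nonneg hq.cΔ_nonneg hq.A₀_nonneg hq.c61_nonneg hq'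
  have hA0₂ := A0_strong_of_184 Δ.tri Δ.dist_nonneg hq.δ₀_nonneg Δ.rowSum hq.c61_nonneg hq.BG₂_nonneg hq.θW_nonneg
    hq.cΔ_nonneg hq.A₀_nonneg hCA (hV.majG₂ n β hβ0 hβ) h189 (hV.majD2H0) (hV.majH0) hA0 h184
  have h190 := dH_majorant_of_182 (bout := Δ.bout V₀ n β) Δ.tri Δ.dist_nonneg hq.δ₀_nonneg Δ.rowSum hCA hq.A₀_nonneg
    hq.A₀₂_pos.le hq.AH₂_nonneg hq.θD_nonneg hA0 (hV.majH0) hA0₂ (hV.majH0₂ n β hβ0 hβ)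
    (hV.majH₂ n β hβ0 hβ) h73 h182
  rw [Δ.κB_eq, Δ.κN_eq, Δ.κ3_eq] at h190
  exact h190

/-- The prefactors of (190) are non-negative. [cite: Balaban1985Variational, (190) p.308] -/
theorem pref190_nonneg {t : ℝ} (ht : 0 ≤ t) (β : ℝ) (n : Fin 5) : 0 ≤ B11.pref190 t β n := by
  fin_cases n <;> simp [B11.pref190] <;> first | exact Real.rpow_nonneg ht _ | positivity

/-- A block majorant bounds the normalised entries. [folklore] -/
private theorem entry_le_of_hasMaj {bo : BlockNorm Δ.g 𝒴} {T : (ι → 𝔄) →ₗ[ℝ] 𝒴} {K : Δ.g.Site → Δ.g.Site → ℝ}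
    (h : HasMaj Δ.bB bo T K) {y y' : Δ.g.Site} (hK : 0 ≤ K y y') : Δ.entry bo T y y' ≤ K y y' := by
  refine Real.sSup_le (fun r hr => ?_) hK
  obtain ⟨μ, hloc, hle, rfl⟩ := hr
  exact (h y' μ hloc y).trans (mul_le_of_le_one_right hK hle)

/-- **The inequalities (190) in the displayed form** for the model's entries: for |B| < 2C₁ε₁, 0 < ε₁ ≤ cthr, V₀ with (7), n = 0,…,4,
0 ≤ β ≤ β₀, y, y′ ∈ 𝔅_k:  `dH n β V₀ B y y′ ≤ O1 · pref190(Lʲη, β)_n · (L^{j′}η)^{−d} · exp(−⅛δ₀d(y,y′))`.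
[cite: Balaban1985Variational, (190) p.308, Prop. 9 p.309] -/
theorem dH_le (hq : q.Valid) {ε₁ : ℝ} (hε₁ : 0 < ε₁) (hε : ε₁ ≤ q.cthr) {V₀ : Bdry} (hV : Δ.Letters V₀)
    {B : ι → 𝔄} (hB : ‖B‖ < 2 * q.C₁ * ε₁) (n : Fin 5) {β : ℝ} (hβ0 : 0 ≤ β) (hβ : β ≤ q.β₀) (y y' : Δ.g.Site) :
    Δ.dHEntry n β V₀ B y y' ≤
      q.O1 * B11.pref190 (Δ.g.L ^ Δ.g.scale y * Δ.g.eta) β n * (Δ.g.L ^ Δ.g.scale y' * Δ.g.eta) ^ (-(q.d : ℝ)) *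
        Real.exp (-(q.δ₀ / 8) * Δ.g.dist y y') := by
  have h190 := ineq190_model hq hε₁ hε hV hB (n := n) hβ0 hβ
  have hO1 := (GConsts.O1_pos hq).le
  have hK : 0 ≤ q.O1 * Real.exp (-(q.δ₀ / 8 * Δ.g.dist y y')) := mul_nonneg hO1 (Real.exp_nonneg _)
  have hent := entry_le_of_hasMaj (Δ := Δ) h190 (y := y) (y' := y') hK
  have ht : ∀ z : Δ.g.Site, 0 ≤ Δ.g.L ^ Δ.g.scale z * Δ.g.eta := fun z =>
    mul_nonneg (pow_nonneg Δ.L_pos.le _) Δ.eta_pos.le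
  have hp := pref190_nonneg (ht y) β n
  have hw : 0 ≤ (Δ.g.L ^ Δ.g.scale y' * Δ.g.eta) ^ (-(q.d : ℝ)) := Real.rpow_nonneg (ht y') _
  unfold dHEntry
  have e : Real.exp (-(q.δ₀ / 8) * Δ.g.dist y y') = Real.exp (-(q.δ₀ / 8 * Δ.g.dist y y')) := by rw [neg_mul]
  rw [e]
  calc B11.pref190 (Δ.g.L ^ Δ.g.scale y * Δ.g.eta) β n * (Δ.g.L ^ Δ.g.scale y' * Δ.g.eta) ^ (-(q.d : ℝ)) *
        Δ.entry (Δ.bout V₀ n β) ((fderiv ℂ (Δ.chart V₀) B).restrictScalars ℝ : (ι → 𝔄) →ₗ[ℝ] 𝒴) y y'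
      ≤ B11.pref190 (Δ.g.L ^ Δ.g.scale y * Δ.g.eta) β n * (Δ.g.L ^ Δ.g.scale y' * Δ.g.eta) ^ (-(q.d : ℝ)) *
        (q.O1 * Real.exp (-(q.δ₀ / 8 * Δ.g.dist y y'))) :=
        mul_le_mul_of_nonneg_left hent (mul_nonneg hp hw)
    _ = _ := by ring

end Clauses

end SectGDatum

/-! ## §4 Proposition 9 for the model family -/

section Family

variable {q : GConsts} {I : Type} {𝔄f ιf 𝒴f 𝒵f Bdryf : I → Type} [∀ i, NormedRing (𝔄f i)] [∀ i, NormedAlgebra ℂ (𝔄f i)]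
  [∀ i, CompleteSpace (𝔄f i)] [∀ i, Fintype (ιf i)] [∀ i, NormedAddCommGroup (𝒴f i)] [∀ i, NormedSpace ℂ (𝒴f i)]
  [∀ i, CompleteSpace (𝒴f i)] [∀ i, NormedAddCommGroup (𝒵f i)] [∀ i, NormedSpace ℂ (𝒵f i)] [∀ i, CompleteSpace (𝒵f i)]

/-- **Proposition 9 (p. 309) — the typed statement of record `B11.Prop9Printed B₅ C₁ β₀ δ₀ fam` INHABITED BY NAME for the model family**
of Sect. G data `δ i` (carriers varying with the index, the printed constants `q` shared), for every B₅ ≥ `B5 q`: with O(1) := `O1 q` and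
the threshold `cthr q` chosen BEFORE the index, for every i, every 0 < ε₁ ≤ cthr and every V₀ with (7): U_k(V′V₀) (read through its
Landau-gauge generator) is an analytic function of the small configurations |V′ − 1| < C₁ε₁ and its analytic continuation along that domain
is unique; 𝓗 is analytic on |B| < 2C₁ε₁; and for every such B: 𝓗(B) is determined by (179)–(180), ‖𝓗(B)‖ < B₅ε₁, and the five entries of
(190) hold with O(1) at the rate ⅛δ₀.  Proof = §3 (the printed route: Prop. 6's regime at the data of (180); (182)–(188); (189) + Lemma 2.1
⇒ (190); (172)); the analytic inputs are data of the index (NOT proved). [cite: Balaban1985Variational, Prop. 9 p.309] -/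
theorem prop9Printed_model_of_le (hq : q.Valid) {B₅ : ℝ} (hB₅ : q.B5 ≤ B₅)
    (δ : ∀ i, SectGDatum q (𝔄f i) (ιf i) (𝒴f i) (𝒵f i) (Bdryf i)) :
    B11.Prop9Printed B₅ q.C₁ q.β₀ q.δ₀ (fun i => (δ i).toAnData) := by
  refine ⟨q.O1, q.cthr, GConsts.O1_pos hq, GConsts.cthr_pos hq, ?_⟩
  intro i ε₁ hε₁ hε V₀ hV
  refine ⟨(δ i).extAnalytic_model hq hε₁ hε hV, (δ i).extOrbits_model hq hε₁ hε hV,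
    (δ i).hAnalytic_model hq hε₁ hε hV, fun (B : ιf i → 𝔄f i) (hB' : ‖B‖ < 2 * q.C₁ * ε₁) => ?_⟩
  refine ⟨(δ i).hDet_model hq hε₁ hε hV hB', (δ i).hIn19_21_model hq hε₁ hε hV hB' hB₅, ?_⟩
  intro n β hβ0 hβ y y'
  exact (δ i).dH_le hq hε₁ hε hV hB' n hβ0 hβ y y'

/-- **Proposition 9 for the model family at the model's own B₅ = 2(λ + α).** [cite: Balaban1985Variational, Prop. 9 p.309] -/
theorem prop9Printed_model (hq : q.Valid) (δ : ∀ i, SectGDatum q (𝔄f i) (ιf i) (𝒴f i) (𝒵f i) (Bdryf i)) :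
    B11.Prop9Printed q.B5 q.C₁ q.β₀ q.δ₀ (fun i => (δ i).toAnData) :=
  prop9Printed_model_of_le hq le_rfl δ

end Family

end Literature.MathematicalPhysics.QuantumFieldTheory.Balaban1983to89.B11Prop9Model

end
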